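import Summits.Langlands.Langlands.Statement
import Literature.NumberTheory.Automorphic.RamakrishnanTensorProductGL2
import HarnessLib

/-!
# `TensorGaloisToAutomorphicQ3_onpath` — F4 on-path lemma (forward generator G4, generation 5)

`Langlands → TensorGaloisToAutomorphicQ k` for every `k` (in particular the rung `k = 3`): the summit's clause (B)
at rank `2 ^ k` over `ℚ` for the reciprocity datum it provides; the sector's de Rham clause is against `Rec.pst`
by `rfl`; a cuspidal datum is in particular an automorphic one and `Corresponds` contains the a.e. Satake clause.
No `sorry`.  (Written against the CURRENT `_root_.Langlands`, re-typed 2026-08-17.)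
-/

noncomputable section

set_option linter.dupNamespace false

open scoped MatrixGroups Matrix NumberField Classical Polynomial
open Filter IsDedekindDomain Field Polynomial
open Literature.NumberTheory.Automorphic Literature.NumberTheory.GaloisRepresentations
open Literature.NumberTheory.PAdicHodge
open Summit.Langlands

namespace Summit.Langlands.Langlands.Cruxes.ReciprocityUpToIrreducibility.TensorGaloisToAutomorphicQ3

/-- Iterated `satakeTensor` of a list of Satake parameters (`[α, β] ↦ {αᵢ βⱼ}`,
`[α, β, γ] ↦ {αᵢ βⱼ γₖ}`; the empty tensor product is the trivial parameter `{1}`). [folklore] -/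
def satakeTensorFold : List (Multiset ℂ) → Multiset ℂ
  | [] => {1}
  | [α] => α
  | α :: β :: l => satakeTensor α (satakeTensorFold (β :: l))

@[simp] theorem satakeTensorFold_pair (α β : Multiset ℂ) :
    satakeTensorFold [α, β] = satakeTensor α β := rfl

@[simp] theorem satakeTensorFold_triple (α β γ : Multiset ℂ) :
    satakeTensorFold [α, β, γ] = satakeTensor α (satakeTensor β γ) := rfl

/-- The `GL₂` FACTOR SECTOR (at `F = ℚ` verbatim the hypotheses of the tree item
`DyadicOddResidue.OddPrimesRegularFM`, stmt-Langlands-18743; stated for any number field so that the sector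
predicate `InTensorSector` below makes sense at every `(F, n)`): `σ : Γ_F → GL₂(ℚ̄_ℓ)` irreducible, odd,
unramified at all but finitely many places, de Rham at every `v ∣ ℓ` for the PINNED Fontaine datum with
distinct labelled Hodge–Tate weights. -/
def InOddRegularSectorGL2 {F : Type} [Field F] [NumberField F] {ℓ : ℕ} [Fact ℓ.Prime]
    (σ : Literature.NumberTheory.GaloisRepresentations.FramedGaloisRep F (PadicAlgCl ℓ) 2) : Prop :=
  σ.toGaloisRep.IsIrreducible ∧ σ.IsOdd ∧
    (∀ᶠ v : IsDedekindDomain.HeightOneSpectrum (NumberField.RingOfIntegers F) in Filter.cofinite,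
      σ.IsUnramifiedAt v) ∧
    ∀ (v : IsDedekindDomain.HeightOneSpectrum (NumberField.RingOfIntegers F))
      (hv : ((ℓ : ℕ) : NumberField.RingOfIntegers F) ∈ v.asIdeal),
      (Literature.NumberTheory.PAdicHodge.fontainePstAdicCompletion v ℓ hv).IsDeRhamFramed (σ.toLocal v) ∧
      ∀ τ : v.adicCompletion F →+* PadicAlgCl ℓ, Continuous τ →
        (σ.labelledHodgeTateWeightsAt v
          (Literature.NumberTheory.PAdicHodge.fontainePstAdicCompletion v ℓ hv).algebra
          (Literature.NumberTheory.PAdicHodge.fontainePstAdicCompletion v ℓ hv).𝔅 τ).Nodup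

/-- **The TENSOR SECTOR at `(F, n, ℓ, ι)`** (used only by the merge / off-sector statements of the ladder
skeleton): `ℓ` odd, `n = 2 ^ k` with `k ≥ 2`, and `k` representations of the `GL₂` factor sector whose
Frobenius characteristic polynomials tensor (through `ι`, a.e.) to those of `ρ`.  Degree-agnostic: the
tensor clause is a statement about characteristic polynomials, so no transport along `n = 2 ^ k` is needed. -/
def InTensorSector {F : Type} [Field F] [NumberField F] {ℓ : ℕ} [Fact ℓ.Prime] {n : ℕ}
    (ι : PadicAlgCl ℓ ≃+* ℂ)
    (ρ : Literature.NumberTheory.GaloisRepresentations.FramedGaloisRep F (PadicAlgCl ℓ) n) : Prop :=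
  ℓ ≠ 2 ∧ ∃ k : ℕ, 2 ≤ k ∧ n = 2 ^ k ∧
    ∃ σ : Fin k → Literature.NumberTheory.GaloisRepresentations.FramedGaloisRep F (PadicAlgCl ℓ) 2,
      (∀ i, InOddRegularSectorGL2 (σ i)) ∧
      ∀ᶠ v : IsDedekindDomain.HeightOneSpectrum (NumberField.RingOfIntegers F) in Filter.cofinite,
        ∀ α : Fin k → Multiset ℂ,
          (∀ i, (σ i).HasFrobCharpolyAt v
            (Literature.NumberTheory.Automorphic.arithFrobPolyOfSatake ι v.residueCard 1 (α i))) →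
          ρ.HasFrobCharpolyAt v
            (Literature.NumberTheory.Automorphic.arithFrobPolyOfSatake ι v.residueCard 1
              (satakeTensorFold (List.ofFn α)))

/-- **The rung family** (dial = tensor length `k`, rank `2 ^ k`): clause (B) over `ℚ` at odd `ℓ`, in the
a.e.-Satake form, for irreducible geometric `ρ : Γ_ℚ → GL_{2^k}(ℚ̄_ℓ)` whose Frobenius characteristic
polynomials are, at all but finitely many places, the tensor products (through `ι`) of those of `k`
representations `σ_i` of the `GL₂` factor sector — the unramified shadow of `ρ ≅ σ₁ ⊗ ⋯ ⊗ σ_k`.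
Conclusion: an AUTOMORPHIC (Borel–Jacquet datum, not asserted cuspidal) `P` on `GL_{2^k}(𝔸_ℚ)` with
`SatakeFrobCompatibleAt ι Π ρ v` for almost all `v`. -/
def TensorGaloisToAutomorphicQ (k : ℕ) : Prop :=
  ∀ (ℓ : ℕ) [Fact ℓ.Prime], ℓ ≠ 2 → ∀ (ι : PadicAlgCl ℓ ≃+* ℂ)
    (ρ : Literature.NumberTheory.GaloisRepresentations.FramedGaloisRep ℚ (PadicAlgCl ℓ) (2 ^ k))
    (σ : Fin k → Literature.NumberTheory.GaloisRepresentations.FramedGaloisRep ℚ (PadicAlgCl ℓ) 2),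
    ρ.toGaloisRep.IsIrreducible →
    (∀ᶠ v : IsDedekindDomain.HeightOneSpectrum (NumberField.RingOfIntegers ℚ) in Filter.cofinite,
      ρ.IsUnramifiedAt v) →
    (∀ (v : IsDedekindDomain.HeightOneSpectrum (NumberField.RingOfIntegers ℚ))
      (hv : ((ℓ : ℕ) : NumberField.RingOfIntegers ℚ) ∈ v.asIdeal),
      (Literature.NumberTheory.PAdicHodge.fontainePstAdicCompletion v ℓ hv).IsDeRhamFramed (ρ.toLocal v)) →
    (∀ i, InOddRegularSectorGL2 (σ i)) →
    (∀ᶠ v : IsDedekindDomain.HeightOneSpectrum (NumberField.RingOfIntegers ℚ) in Filter.cofinite,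
      ∀ α : Fin k → Multiset ℂ,
        (∀ i, (σ i).HasFrobCharpolyAt v
          (Literature.NumberTheory.Automorphic.arithFrobPolyOfSatake ι v.residueCard 1 (α i))) →
        ρ.HasFrobCharpolyAt v
          (Literature.NumberTheory.Automorphic.arithFrobPolyOfSatake ι v.residueCard 1
            (satakeTensorFold (List.ofFn α)))) →
    ∀ hcpt : Literature.NumberTheory.Automorphic.isCompact_glFiniteIntegralLevel (2 ^ k) ℚ,
      ∃ P : Literature.NumberTheory.Automorphic.AutomorphicRepData
          (Literature.NumberTheory.Automorphic.AutomorphyDatum.gl (2 ^ k) ℚ hcpt),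
        ∀ᶠ v : IsDedekindDomain.HeightOneSpectrum (NumberField.RingOfIntegers ℚ) in Filter.cofinite,
          Summit.Langlands.SatakeFrobCompatibleAt ι P ρ v

/-- **THE RUNG** (the filed statement): the family at `k = 3` — `GL₂ × GL₂ × GL₂ → GL₈` reciprocity over `ℚ`. -/
def TensorGaloisToAutomorphicQ3 : Prop := TensorGaloisToAutomorphicQ 3


/-- **Dial monotonicity in the summit direction**: the summit gives every rung of the family. -/
theorem tensorGaloisToAutomorphicQ_of_langlands (k : ℕ) (hL : _root_.Langlands) :
    TensorGaloisToAutomorphicQ k := by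
  intro ℓ _ _hℓ ι ρ σ hirr hunr hdR _hσ _htensor hcpt
  obtain ⟨⟨Rec⟩, hall⟩ := hL ℚ
  have hB : GaloisToAutomorphic (2 ^ k) Rec hcpt := (hall Rec (2 ^ k) (by positivity) hcpt).2
  have hgeo : IsGeometricFramed Rec ρ := ⟨hunr, fun v hv => hdR v hv⟩
  obtain ⟨π, -, hcorr⟩ := hB ℓ ι ρ hirr hgeo
  exact ⟨π.1, hcorr.1⟩

/-- **F4 on-path lemma for the rung**: `Langlands → TensorGaloisToAutomorphicQ3`. -/
@[aesop safe apply]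
theorem TensorGaloisToAutomorphicQ3_of_Langlands (hL : _root_.Langlands) : TensorGaloisToAutomorphicQ3 :=
  tensorGaloisToAutomorphicQ_of_langlands 3 hL

end Summit.Langlands.Langlands.Cruxes.ReciprocityUpToIrreducibility.TensorGaloisToAutomorphicQ3

end
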